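import Mathlib
import Literature.Uncategorized.SlowSmoothMinorant
import HarnessLib

/-!
# SlowSmoothMinorant — the proof (`SlowSmoothMinorant_holds`)

Discharge of the named fact `Literature.Uncategorized.SlowSmoothMinorant` (file
`Literature/Uncategorized/SlowSmoothMinorant.lean`, statement untouched): for every monotone
`g : ℝ → ℝ` with `g → +∞` and every floor `b` there is a `C^∞`, non-decreasing `ϱ → +∞` with
`b ≤ ϱ`, `ϱ + 6 ≤ g` from some threshold on, and `|ϱ′|, |ϱ″|, |ϱ‴| ≤ 1` on all of `ℝ`.

Elementary and self-contained real analysis ([folklore]: a smooth "staircase" of widely spaced,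
slowly climbed unit steps `H = Real.smoothTransition`, the usual smooth-cutoff technology; pure
Mathlib, this file declares no definition — the staircase is handled through its characterising
equation `hϱ`, a hypothesis).  The same argument was first written Summits-side as
`stub_slowSmoothMinorant`
(`Summits/FinalStateConjecture/FinalStateConjecture/Theorems/StarvedNecksNeckGapDecayStubSlowSmoothMinorant.lean`);
Literature cannot import Summits, so it is vendored here next to the fact.

Construction:
* `H := Real.smoothTransition` is a smooth non-decreasing step, `= 0` on `(-∞, 0]`, `= 1` on
  `[1, ∞)`; each of its derivatives of order `k ≥ 1` vanishes off `[0, 1]`, hence is bounded on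
  `ℝ` by a constant `C k`; put `L := max 1 (max (C 1) (max (C 2) (C 3)))`;
* thresholds `S n` with `b + n + 8 ≤ g` on `[S n, ∞)` (from `g → +∞`), and times
  `T 0 := S 0`, `T (n + 1) := max (S (n + 1)) (T n + L + 1)`, so `T (n + 1) ≥ T n + L + 1`;
* the staircase `ϱ u := b + ∑' n, H ((u - T n) / L)`: below `T M` only the terms `n < M` are
  non-zero, and on the window `(T m - 1, T (m + 1))` one has exactly `ϱ u = b + m + H ((u - T m) / L)`
  (the earlier steps are complete, the later ones have not started).  Hence `ϱ` is smooth,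
  monotone, `≥ b`, `ϱ (T m + L) = b + m + 1 → ∞`, `ϱ ≤ b + m + 1 ≤ g - 7` on `[T m, T (m + 1))`, and
  `|ϱ^{(k)}| = L^{-k} |H^{(k)}| ≤ C k / L ≤ 1` for `k = 1, 2, 3`.

* `Literature.Uncategorized.SlowSmoothMinorant_holds` — the discharge.
-/

namespace Literature.Uncategorized

open Filter Set _root_.Topology
open scoped ContDiff

/-! ### The smooth unit step `H = Real.smoothTransition`: derivatives -/

/-- The derivatives of order `k ≥ 1` of the smooth step vanish on `(-∞, 0)`, where it is locally
the constant `0`. [folklore] -/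
private lemma iteratedDeriv_smoothTransition_of_neg {k : ℕ} (hk : k ≠ 0) {x : ℝ} (hx : x < 0) :
    iteratedDeriv k Real.smoothTransition x = 0 := by
  have h : Real.smoothTransition =ᶠ[𝓝 x] fun _ ↦ (0 : ℝ) :=
    Filter.eventuallyEq_of_mem (Iio_mem_nhds hx)
      fun y hy ↦ Real.smoothTransition.zero_of_nonpos (le_of_lt hy)
  rw [h.iteratedDeriv_eq k, iteratedDeriv_const, if_neg hk]

/-- The derivatives of order `k ≥ 1` of the smooth step vanish on `(1, ∞)`, where it is locally
the constant `1`. [folklore] -/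
private lemma iteratedDeriv_smoothTransition_of_one_lt {k : ℕ} (hk : k ≠ 0) {x : ℝ} (hx : 1 < x) :
    iteratedDeriv k Real.smoothTransition x = 0 := by
  have h : Real.smoothTransition =ᶠ[𝓝 x] fun _ ↦ (1 : ℝ) :=
    Filter.eventuallyEq_of_mem (Ioi_mem_nhds hx)
      fun y hy ↦ Real.smoothTransition.one_of_one_le (le_of_lt hy)
  rw [h.iteratedDeriv_eq k, iteratedDeriv_const, if_neg hk]

/-- Each derivative of order `k ≥ 1` of the smooth step is bounded on `ℝ` (continuous, and zero
off the compact interval `[0, 1]`). [folklore] -/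
private lemma exists_abs_iteratedDeriv_smoothTransition_le {k : ℕ} (hk : k ≠ 0) :
    ∃ C, ∀ x, |iteratedDeriv k Real.smoothTransition x| ≤ C := by
  have hcont : Continuous (iteratedDeriv k Real.smoothTransition) :=
    (Real.smoothTransition.contDiff (n := ⊤)).continuous_iteratedDeriv k (mod_cast le_top)
  obtain ⟨C, hC⟩ :=
    (isCompact_Icc : IsCompact (Icc (0 : ℝ) 1)).exists_bound_of_continuousOn hcont.continuousOn
  have hC0 : 0 ≤ C := (norm_nonneg _).trans (hC 0 ⟨le_rfl, zero_le_one⟩)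
  refine ⟨C, fun x ↦ ?_⟩
  rcases lt_or_ge x 0 with h0 | h0
  · rw [iteratedDeriv_smoothTransition_of_neg hk h0, abs_zero]
    exact hC0
  rcases le_or_gt x 1 with h1 | h1
  · have h := hC x ⟨h0, h1⟩
    rwa [Real.norm_eq_abs] at h
  · rw [iteratedDeriv_smoothTransition_of_one_lt hk h1, abs_zero]
    exact hC0

/-- Chain rule for one rescaled, translated step: the `k`-th derivative (`k ≥ 1`) of
`v ↦ c + H ((v - s) / L)` is `L^{-k} H^{(k)} ((u - s) / L)`. [folklore] -/
private lemma iteratedDeriv_step {k : ℕ} (hk : k ≠ 0) (c s L u : ℝ) :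
    iteratedDeriv k (fun v ↦ c + Real.smoothTransition ((v - s) / L)) u =
      L⁻¹ ^ k * iteratedDeriv k Real.smoothTransition ((u - s) / L) := by
  have h1 : (fun v ↦ c + Real.smoothTransition ((v - s) / L)) =
      fun v ↦ c + Real.smoothTransition (L⁻¹ * (v - s)) := by
    funext v
    rw [div_eq_inv_mul]
  have h2 := congrFun (iteratedDeriv_comp_sub_const k
    (fun y ↦ Real.smoothTransition (L⁻¹ * y)) s) u
  have h3 := congrFun (iteratedDeriv_comp_const_mul (n := k)
    (Real.smoothTransition.contDiff (n := k)) L⁻¹) (u - s)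
  rw [h1, iteratedDeriv_const_add (Nat.pos_of_ne_zero hk), h2, h3, div_eq_inv_mul]

/-- One rescaled, translated step `v ↦ c + H ((v - s) / L)` is smooth. [folklore] -/
private lemma contDiff_step (c s L : ℝ) :
    ContDiff ℝ ∞ (fun v ↦ c + Real.smoothTransition ((v - s) / L)) :=
  contDiff_const.add
    (Real.smoothTransition.contDiff.comp ((contDiff_id.sub contDiff_const).div_const L))

section Staircase

/-! ### The staircase `ϱ u = b + ∑' n, H ((u - T n) / L)`, via its defining equation -/

variable {T : ℕ → ℝ} {L b : ℝ} {ϱ : ℝ → ℝ}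

/-- The times increase: `T n < T (n + 1)`. [folklore] -/
private lemma T_lt_succ (hL : 1 ≤ L) (hT : ∀ n, T n + L + 1 ≤ T (n + 1)) (n : ℕ) :
    T n < T (n + 1) := by
  have h := hT n
  linarith

/-- The times are monotone. [folklore] -/
private lemma T_mono (hL : 1 ≤ L) (hT : ∀ n, T n + L + 1 ≤ T (n + 1)) : Monotone T :=
  (strictMono_nat_of_lt_succ (T_lt_succ hL hT)).monotone

/-- Spacing of the times: `T n + L + 1 ≤ T m` for `n < m`. [folklore] -/
private lemma T_add_le (hL : 1 ≤ L) (hT : ∀ n, T n + L + 1 ≤ T (n + 1)) {n m : ℕ} (h : n < m) :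
    T n + L + 1 ≤ T m :=
  (hT n).trans (T_mono hL hT (Nat.succ_le_of_lt h))

/-- Linear growth of the times: `T 0 + n ≤ T n`. [folklore] -/
private lemma T_zero_add_le (hL : 1 ≤ L) (hT : ∀ n, T n + L + 1 ≤ T (n + 1)) (n : ℕ) :
    T 0 + n ≤ T n := by
  induction n with
  | zero => simp
  | succ n ih =>
    have h := hT n
    push_cast
    linarith

/-- The times are unbounded. [folklore] -/
private lemma exists_lt_T (hL : 1 ≤ L) (hT : ∀ n, T n + L + 1 ≤ T (n + 1)) (u : ℝ) :
    ∃ n, u < T n := by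
  obtain ⟨n, hn⟩ := exists_nat_gt (u - T 0)
  have h := T_zero_add_le hL hT n
  exact ⟨n, by linarith⟩

/-- Point location: every `u ≥ T 0` lies in a unique `[T m, T (m + 1))`. [folklore] -/
private lemma exists_T_le_lt (hL : 1 ≤ L) (hT : ∀ n, T n + L + 1 ≤ T (n + 1)) {u : ℝ}
    (hu : T 0 ≤ u) : ∃ m, T m ≤ u ∧ u < T (m + 1) := by
  by_contra h
  push Not at h
  have hall : ∀ n, T n ≤ u := by
    intro n
    induction n with
    | zero => exact hu
    | succ n ih => exact h n ih
  obtain ⟨n, hn⟩ := exists_lt_T hL hT u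
  exact lt_irrefl u (hn.trans_le (hall n))

/-- On `(T m - 1, ∞)` all the steps `n < m` are complete: `T n + L ≤ u`. [folklore] -/
private lemma T_add_le_of_lt (hL : 1 ≤ L) (hT : ∀ n, T n + L + 1 ≤ T (n + 1)) {m : ℕ} {u : ℝ}
    (hu : T m - 1 ≤ u) : ∀ n < m, T n + L ≤ u := fun n hn ↦ by
  have h := T_add_le hL hT hn
  linarith

/-- Finite-sum representation: below `T M` only the steps `n < M` contribute. [folklore] -/
private lemma rho_eq_sum (hL : 1 ≤ L) (hT : ∀ n, T n + L + 1 ≤ T (n + 1))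
    (hϱ : ∀ u, ϱ u = b + ∑' n, Real.smoothTransition ((u - T n) / L)) {M : ℕ} {u : ℝ}
    (hu : u < T M) : ϱ u = b + ∑ n ∈ Finset.range M, Real.smoothTransition ((u - T n) / L) := by
  rw [hϱ u]
  congr 1
  refine tsum_eq_sum fun n hn ↦ ?_
  rw [Finset.mem_range, not_lt] at hn
  have h1 : T M ≤ T n := T_mono hL hT hn
  exact Real.smoothTransition.zero_of_nonpos
    (div_nonpos_of_nonpos_of_nonneg (by linarith) (by linarith))

/-- Single-step representation: if `u < T (m + 1)` and the steps `n < m` are complete at `u`, then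
`ϱ u = b + m + H ((u - T m) / L)`. [folklore] -/
private lemma rho_eq_step (hL : 1 ≤ L) (hT : ∀ n, T n + L + 1 ≤ T (n + 1))
    (hϱ : ∀ u, ϱ u = b + ∑' n, Real.smoothTransition ((u - T n) / L)) {m : ℕ} {u : ℝ}
    (hu : u < T (m + 1)) (hside : ∀ n < m, T n + L ≤ u) :
    ϱ u = b + m + Real.smoothTransition ((u - T m) / L) := by
  have h1 : ∑ n ∈ Finset.range m, Real.smoothTransition ((u - T n) / L) =
      ∑ n ∈ Finset.range m, (1 : ℝ) := by
    refine Finset.sum_congr rfl fun n hn ↦ ?_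
    rw [Finset.mem_range] at hn
    have h2 := hside n hn
    exact Real.smoothTransition.one_of_one_le ((one_le_div (by linarith)).2 (by linarith))
  rw [rho_eq_sum hL hT hϱ hu, Finset.sum_range_succ, h1]
  simp only [Finset.sum_const, Finset.card_range, nsmul_eq_mul, mul_one]
  ring

/-- Local single-step representation: near every point, `ϱ` is one rescaled, translated step plus
a constant. [folklore] -/
private lemma rho_eventuallyEq_step (hL : 1 ≤ L) (hT : ∀ n, T n + L + 1 ≤ T (n + 1))
    (hϱ : ∀ u, ϱ u = b + ∑' n, Real.smoothTransition ((u - T n) / L)) (u₀ : ℝ) :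
    ∃ m : ℕ, ϱ =ᶠ[𝓝 u₀] fun u ↦ b + m + Real.smoothTransition ((u - T m) / L) := by
  rcases lt_or_ge u₀ (T 0) with h0 | h0
  · refine ⟨0, Filter.eventuallyEq_of_mem (Iio_mem_nhds (h0.trans (T_lt_succ hL hT 0)))
      fun u hu ↦ ?_⟩
    exact rho_eq_step hL hT hϱ hu fun n hn ↦ absurd hn (Nat.not_lt_zero n)
  · obtain ⟨m, hm1, hm2⟩ := exists_T_le_lt hL hT h0
    refine ⟨m, Filter.eventuallyEq_of_mem (Ioo_mem_nhds ((sub_one_lt (T m)).trans_le hm1) hm2)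
      fun u hu ↦ ?_⟩
    exact rho_eq_step hL hT hϱ hu.2 (T_add_le_of_lt hL hT hu.1.le)

/-- The staircase is smooth. [folklore] -/
private lemma rho_contDiff (hL : 1 ≤ L) (hT : ∀ n, T n + L + 1 ≤ T (n + 1))
    (hϱ : ∀ u, ϱ u = b + ∑' n, Real.smoothTransition ((u - T n) / L)) : ContDiff ℝ ∞ ϱ :=
  contDiff_iff_contDiffAt.2 fun u₀ ↦ by
    obtain ⟨m, hm⟩ := rho_eventuallyEq_step hL hT hϱ u₀
    exact (contDiff_step _ _ _).contDiffAt.congr_of_eventuallyEq hm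

/-- Derivative bound: if `|H^{(k)}| ≤ C ≤ L` (`k ≥ 1`) then `|ϱ^{(k)}| ≤ 1`. [folklore] -/
private lemma abs_iteratedDeriv_rho_le (hL : 1 ≤ L) (hT : ∀ n, T n + L + 1 ≤ T (n + 1))
    (hϱ : ∀ u, ϱ u = b + ∑' n, Real.smoothTransition ((u - T n) / L)) {k : ℕ} (hk : k ≠ 0)
    {C : ℝ} (hC : ∀ x, |iteratedDeriv k Real.smoothTransition x| ≤ C) (hCL : C ≤ L) (u₀ : ℝ) :
    |iteratedDeriv k ϱ u₀| ≤ 1 := by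
  obtain ⟨m, hm⟩ := rho_eventuallyEq_step hL hT hϱ u₀
  have hL0 : 0 < L := by linarith
  rw [hm.iteratedDeriv_eq k, iteratedDeriv_step hk, abs_mul,
    abs_of_nonneg (pow_nonneg (inv_nonneg.2 hL0.le) k)]
  have h1 : L⁻¹ ^ k ≤ L⁻¹ :=
    pow_le_of_le_one (inv_nonneg.2 hL0.le) (inv_le_one_of_one_le₀ hL) hk
  calc L⁻¹ ^ k * |iteratedDeriv k Real.smoothTransition ((u₀ - T m) / L)| ≤ L⁻¹ * C :=
      mul_le_mul h1 (hC _) (abs_nonneg _) (inv_nonneg.2 hL0.le)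
    _ ≤ 1 := by
      rw [inv_mul_le_iff₀ hL0]
      linarith

/-- The staircase is non-decreasing (each step is). [folklore] -/
private lemma rho_monotone (hL : 1 ≤ L) (hT : ∀ n, T n + L + 1 ≤ T (n + 1))
    (hϱ : ∀ u, ϱ u = b + ∑' n, Real.smoothTransition ((u - T n) / L)) : Monotone ϱ := by
  intro u v huv
  obtain ⟨M, hM⟩ := exists_lt_T hL hT v
  rw [rho_eq_sum hL hT hϱ (huv.trans_lt hM), rho_eq_sum hL hT hϱ hM]
  refine add_le_add le_rfl (Finset.sum_le_sum fun n _ ↦ ?_)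
  exact Real.smoothTransition.monotone (div_le_div_of_nonneg_right (by linarith) (by linarith))

/-- The staircase stays above the floor `b`. [folklore] -/
private lemma le_rho (hL : 1 ≤ L) (hT : ∀ n, T n + L + 1 ≤ T (n + 1))
    (hϱ : ∀ u, ϱ u = b + ∑' n, Real.smoothTransition ((u - T n) / L)) (u : ℝ) : b ≤ ϱ u := by
  obtain ⟨M, hM⟩ := exists_lt_T hL hT u
  rw [rho_eq_sum hL hT hϱ hM]
  exact le_add_of_nonneg_right (Finset.sum_nonneg fun n _ ↦ Real.smoothTransition.nonneg _)

/-- After the `m`-th step: `ϱ (T m + L) = b + m + 1`. [folklore] -/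
private lemma rho_T_add (hL : 1 ≤ L) (hT : ∀ n, T n + L + 1 ≤ T (n + 1))
    (hϱ : ∀ u, ϱ u = b + ∑' n, Real.smoothTransition ((u - T n) / L)) (m : ℕ) :
    ϱ (T m + L) = b + m + 1 := by
  have hlt : T m + L < T (m + 1) := by
    have h := hT m
    linarith
  rw [rho_eq_step hL hT hϱ hlt (T_add_le_of_lt hL hT (by linarith)), add_sub_cancel_left,
    div_self (zero_lt_one.trans_le hL).ne', Real.smoothTransition.one]

/-- The staircase tends to `+∞`. [folklore] -/
private lemma tendsto_rho (hL : 1 ≤ L) (hT : ∀ n, T n + L + 1 ≤ T (n + 1))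
    (hϱ : ∀ u, ϱ u = b + ∑' n, Real.smoothTransition ((u - T n) / L)) :
    Tendsto ϱ atTop atTop := by
  refine tendsto_atTop_atTop.2 fun B ↦ ?_
  obtain ⟨m, hm⟩ := exists_nat_gt (B - b)
  refine ⟨T m + L, fun u hu ↦ ?_⟩
  have h1 := rho_monotone hL hT hϱ hu
  rw [rho_T_add hL hT hϱ m] at h1
  linarith

end Staircase

/-- **W4 — slow smooth minorant** holds: discharge of `SlowSmoothMinorant` ([folklore]; the
staircase `ϱ u = b + ∑' n, H ((u - T n) / L)` with `H = Real.smoothTransition`, `L ≥ 1` dominating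
the sup norms of `H′, H″, H‴`, and times `T (n + 1) = max (S (n + 1)) (T n + L + 1)` where
`g ≥ b + n + 8` on `[S n, ∞)`; on `[T m, T (m + 1))` one has `ϱ ≤ b + m + 1 ≤ g - 7`). -/
theorem SlowSmoothMinorant_holds : SlowSmoothMinorant := by
  intro g b _ hg
  -- sup norms of the first three derivatives of the step, and the scale `L`
  obtain ⟨C₁, hC₁⟩ := exists_abs_iteratedDeriv_smoothTransition_le (k := 1) one_ne_zero
  obtain ⟨C₂, hC₂⟩ := exists_abs_iteratedDeriv_smoothTransition_le (k := 2) two_ne_zero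
  obtain ⟨C₃, hC₃⟩ := exists_abs_iteratedDeriv_smoothTransition_le (k := 3) (by norm_num)
  obtain ⟨L, hL, hC₁L, hC₂L, hC₃L⟩ : ∃ L : ℝ, 1 ≤ L ∧ C₁ ≤ L ∧ C₂ ≤ L ∧ C₃ ≤ L :=
    ⟨max 1 (max C₁ (max C₂ C₃)), le_max_left _ _, (le_max_left _ _).trans (le_max_right _ _),
      ((le_max_left _ _).trans (le_max_right C₁ _)).trans (le_max_right _ _),
      ((le_max_right C₂ _).trans (le_max_right C₁ _)).trans (le_max_right _ _)⟩
  -- thresholds `S n` (`g ≥ b + n + 8` beyond `S n`) and the widely spaced times `T n ≥ S n`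
  choose S hS using fun n : ℕ ↦ tendsto_atTop_atTop.1 hg (b + n + 8)
  obtain ⟨T, hT0, hTs⟩ : ∃ T : ℕ → ℝ, T 0 = S 0 ∧
      ∀ n, T (n + 1) = max (S (n + 1)) (T n + L + 1) :=
    ⟨fun n ↦ Nat.rec (motive := fun _ ↦ ℝ) (S 0) (fun k t ↦ max (S (k + 1)) (t + L + 1)) n, rfl,
      fun _ ↦ rfl⟩
  have hT : ∀ n, T n + L + 1 ≤ T (n + 1) := fun n ↦ by
    rw [hTs n]
    exact le_max_right _ _
  have hST : ∀ n, S n ≤ T n := by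
    intro n
    cases n with
    | zero => rw [hT0]
    | succ n =>
      rw [hTs n]
      exact le_max_left _ _
  -- the staircase
  obtain ⟨ϱ, hϱ⟩ : ∃ ϱ : ℝ → ℝ, ∀ u, ϱ u = b + ∑' n, Real.smoothTransition ((u - T n) / L) :=
    ⟨_, fun _ ↦ rfl⟩
  refine ⟨ϱ, rho_contDiff hL hT hϱ, rho_monotone hL hT hϱ, tendsto_rho hL hT hϱ, le_rho hL hT hϱ,
    ⟨T 0, fun u hu ↦ ?_⟩, fun u ↦ ?_, abs_iteratedDeriv_rho_le hL hT hϱ two_ne_zero hC₂ hC₂L,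
    abs_iteratedDeriv_rho_le hL hT hϱ (by norm_num) hC₃ hC₃L⟩
  · -- `ϱ + 6 ≤ g` on `[T 0, ∞)`: locate `u ∈ [T m, T (m + 1))`
    obtain ⟨m, hm1, hm2⟩ := exists_T_le_lt hL hT hu
    rw [rho_eq_step hL hT hϱ hm2 (T_add_le_of_lt hL hT (by linarith))]
    have h1 := Real.smoothTransition.le_one ((u - T m) / L)
    have h2 := hS m u ((hST m).trans hm1)
    linarith
  · rw [← iteratedDeriv_one]
    exact abs_iteratedDeriv_rho_le hL hT hϱ one_ne_zero hC₁ hC₁L u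


end Literature.Uncategorized
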